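import Summits.QuantumFields.BalabanUV.Beta.WardLocusRecursiveZeroSlot
import Summits.QuantumFields.BalabanUV.Beta.LagrangeFoldComposite
import Summits.QuantumFields.BalabanUV.Beta.SymmetrisedStepJetsParity
import Summits.QuantumFields.BalabanUV.Beta.FP.TowerNWardOfTableLaws
import Summits.QuantumFields.BalabanUV.Beta.FP.CompositeOneShotChartParity

/-!
# `BalabanUV.Beta.FP.TowerNWardOfLetters` — row D1 ∕ (C1) OWNER «beta-an2», PART 115, ROUTE T (β1): **THE `hW𝒯 j` END OF THE N-SYSTEM FOR GENERIC COMPOSITE-TRIPLE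
# TABLES, FROM THE LEVEL-0 LETTERS** — PART 103's reduction (`hW𝒯 j` ⟸ (S)_j, (W)_j) with its W-side block (`hWd`, `hNr`, `hN0`) DISCHARGED by PART 112's member-0 cut of
# g29's chain + PART 113's (c1)₀ + `trK_AN`, and its record `JNat` replaced by ANY tables `V H M vh₂S mixFF` at blocking `Lc^(j+1)`: what is displayed is the (S)-law
# `hSd`, its transported form `hD`, and the three level-0 LETTERS (Wilson, border, mixed) with their remainders' classes and parities — nothing of the record

HONEST DEPENDENCY (page 1, mandatory): continuum YM on T⁴ ⇐ BetaPertH ∧ nine spine estimates (0/9 proved); BetaPertH ⇐ (D1) ∧ (D4) ∧ CAP+tail;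
G-an2-4 gates asym, D1 and NE2/3/4.  HONEST FRAMING (cell contract, verbatim): «discharging `BetaPertH` makes Bałaban's UV stability UNCONDITIONAL —
a real constructive-QFT result; it is NOT the continuum limit and NOT the Clay problem.»  ABSOLUTE RULE (cell charter, verbatim): «No internally-minted
statement may enter as a cited fact. Every hypothesis is either kernel-proved in this package or a verbatim quotation of a PUBLISHED theorem with page
reference. The manuscript(s) under audit are NOT citable for their own disputed steps — they are the thing under adjudication; programme-internal
(2001/route/tribunal) claims are never citable.»

WHY (an2 gen 87; HWD-SCOPING §2 item 4; road g64's CENSUS-ᴿ ∕ XREAD-R: the (O3)-class port re-types the RECORD, not the letters).  PART 103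
`FP/TowerNWardOfTableLaws.wardTransversal_AN_of_tableLaws` instantiates road FP's generic coarse Ward END at the composite triple of the RECORD `JNat` and leaves
`hSd hWd hN0` (+ generators) displayed.  Since then the W-side became letters: PART 112 (`exists_wardSide_zero_of_letters_slot`: `hWd` with `X₂ := 0`, `hNr`, `hN0` from the
level-0 letters), PART 113 ((c1)₀ for `AN`, any tables), road `FP/CompositeOneShotChartParity.trK_AN`, an2 g29 `SymmetrisedStepJetsParity.trK_SpureRecOf`.  THIS FILE composes
them ONCE, for GENERIC tables: **`wardTransversal_AN_of_letters`** — for any border table `V` ((LV), (TV), (V-p)), constraint-Hessian table `H` ((LH), (TH), (H-p)) at blocking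
`N = Lc^(j+1)`, multiplier family `M` ((LM), (TM), member-0 pin `M 0 = cΛ • H`), second-order border table `vh₂S` (`hB`, `hBt`), mixed table `mixFF` (`hmix`, `hmixt`), pins
`cE cVH cΛ cE₂ cB T`, generator weight `ξ`: the (S)-law `hSd` of `SrecOf … 0` against `bhKcomp`, its transported form `hD` (g29's first-order law of `dM (AN R j) … (M 0)`), and the
three level-0 letters `hWil hWil″ hBord hBord″ hM₂` with remainders classified at one rate and row-parity-odd IMPLY
`WardTransversal (flipK (hessKer (AN R j) (vertexOfK (AN R j) N (SrecOf 3 N V H _ cE cVH cΛ 0)) (WrecOf 3 N (fun _ ↦ AN R j) (SpureRecOf …) M cE₂ cB T vh₂S mixFF 0)))`.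
At ANY record whose `S`∕`W` are these two families by `rfl` (the record of record `JNat`: `JNat_S`∕`JNat_W`∕`SchartOf_eq`∕`WchartOf_eq`; a rooted record likewise) this IS the END
skeleton's `hW𝒯 j`.  Chart side entirely by name: PART 102 (`relInv_AN`, `colH_ward_AN`, `spr_bhKcomp`, `spr_axEc_AN`, `shiftK_AN_all`, `exists_decays_AN`), PART 107
(`colM_ward_AN`, `AN_inr_inr_off`), an2 `KernelWardLevels` (generator class, `[E, X] = 0`), an2 g29's slot lemmas (`locStencil_SrecOf`, `vertexFamily₂_WrecOf'`,
`SrecOf_translate`, `SpureRecOf_translate`, `WrecOf_translate`).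

WHAT: [folklore] composition BY NAME; no `def`, no `def … : Prop`, nothing cited, 0 sorry.  (S)_j, its transported form and the three (W)_j letters are DISPLAYED (for the
rooted tables they are tree theorems: PART 105b∕109, 108∕109, 114, 106c∕109, 110g∕111 — the instantiation is the referee-gated (O3) port; for the record's sym tables (S)_j is
LOCATED, FINDING AN2-86-1); nothing of Bałaban's asserted, valued or discharged; 0 estimates; 0∕4 row-D1 binders; `hW𝒯 (j ≥ 1)` NOT claimed at the record; NOT (C1), NOT D1,
NEVER «G-an2-4 closed», NOT BetaPertH, NOT continuum, NOT Clay.  Row D1 ∕ (C1) OWNER «beta-an2», gen 87, 2026-08-30.  No existing file touched.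
-/

noncomputable section

open Finset
open scoped BigOperators
open Literature.MathematicalPhysics.QuantumFieldTheory
open Literature.MathematicalPhysics.QuantumFieldTheory.Balaban1983to89
open Literature.MathematicalPhysics.QuantumFieldTheory.Balaban1983to89.Beta
open B6BondElimination (unitVec)
open ExpKernelCalculus (MKer Decays BiLoc comp tadpole hessKer VertexFamily VertexFamily₂ shiftK)
open PolarizationSign (WardTransversal)
open KernelWard (divV divW)
open AffineAveraging (Site box toSite)
open OneStepResolventKernel (Fib wsum LocStencil)
open OneStepKernelFamily (colH vertexOfK flipK)
open InterLevelTransport (cwsum)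
open SecondOrderResponse (colM vertexOfM dM LocStencilFM)
open BalabanCompositeJets (LocStencil₂)
open BalabanStepW2 (M2Of)
open StepJetData (wilsonA)
open WilsonBiStencil (wilsonW₂)
open BalabanStepJets (locStencil_mono vertexFamily₂_mono)
open StepDriftWitness (comp_zero_right)
open Summit.QuantumFields.BalabanUV.Beta.TameKernelCalculus (Loc Spr trK)
open Summit.QuantumFields.BalabanUV.Beta.BorderedHessian (diagK sgnK)
open Summit.QuantumFields.BalabanUV.Beta.ChartConjugation (conjV conjW)
open Summit.QuantumFields.BalabanUV.Beta.AxialDressingRooted (axEc one_le_of_neZero)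
open Summit.QuantumFields.BalabanUV.Beta.RelInvComposite (bhKcomp)
open Summit.QuantumFields.BalabanUV.Beta.AveragingWardRootedStencils (legInd)
open Summit.QuantumFields.BalabanUV.Beta.KernelWardRelative (gaugeWt loc_zero comp_zero_left)
open Summit.QuantumFields.BalabanUV.Beta.KernelWardLevels (loc_diagK_smul_sum_legInd comp_axEc_diagK_smul_sum_legInd_comm)
open Summit.QuantumFields.BalabanUV.Beta.SpineRooted (SpureRecOf WrecOf locStencil_SpureRecOf locStencil_SrecOf SrecOf_translate SpureRecOf_translate
  vertexFamily₂_WrecOf' WrecOf_translate)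
open Summit.QuantumFields.BalabanUV.Beta.WardLocusRecursive (SrecOf)
open Summit.QuantumFields.BalabanUV.Beta.SpineRecursiveParity (parityOdd_smul)
open Summit.QuantumFields.BalabanUV.Beta.SymmetrisedStepJetsParity (trK_SpureRecOf)
open Summit.QuantumFields.BalabanUV.Beta.CompositeOneShotJetData (Roots AN)
open Summit.QuantumFields.BalabanUV.Beta.NVertexSectors (decays_AN)
open Summit.QuantumFields.BalabanUV.Beta.FP.LetterInheritanceEnd (wardTransversal_flipK_hessKer_vertexOfK_of_letters)
open Summit.QuantumFields.BalabanUV.Beta.FP.TowerNColumnWardLaw (colH_ward_AN relInv_AN spr_bhKcomp spr_axEc_AN shiftK_AN_all exists_decays_AN colM_ward_AN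
  AN_inr_inr_off)
open Summit.QuantumFields.BalabanUV.Beta.FP.CompositeOneShotChartParity (trK_AN)
open Summit.QuantumFields.BalabanUV.Beta.WardLocusRecursiveZeroSlot (exists_wardSide_zero_of_letters_slot)
open Summit.QuantumFields.BalabanUV.Beta.LagrangeFoldComposite (dM_SpureRecOf_zero_eq_vertexOfK_SrecOf_AN)

namespace Summit.QuantumFields.BalabanUV.Beta.FP.TowerNWardOfLetters

variable {Lc : ℕ} [NeZero Lc] (R : Roots Lc) (j : ℕ)

/-- [folklore] **`wardTransversal_AN_of_letters` — THE `hW𝒯 j` END OF THE N-SYSTEM FOR GENERIC COMPOSITE-TRIPLE TABLES, FROM THE LEVEL-0 LETTERS.**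
Tables at blocking `N = Lc^(j+1)`: `V` ((LV) `hV`, (TV) `hVt`, (V-p) `hVp`), `H` ((LH) `hH`, (TH) `hHt`, (H-p) `hHp`), multiplier family `M` ((LM) `hM`, (TM) `hMt`, member-0 pin
`hM0 : M 0 = cΛ • H`), `vh₂S` (`hB`, `hBt`), `mixFF` (`hmix`, `hmixt`); pins `cE cVH cΛ cE₂ cB T`; generator `X y := diagK (ξ • Σ_{v ∈ box N} legInd (toSite (R.s (j+1))) (N•y + v))`,
`cH := (N⁴)⁻¹`.  DISPLAYED: the (S)-law `hSd` (PART 103's text with `S := SrecOf 3 N V H _ cE cVH cΛ 0`), its transported form `hD` (g29's first-order law of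
`dM (AN R j) N (SpureRecOf … 0) (M 0)` against `bhKcomp`), and the three level-0 letters `hWil hWil″ hBord hBord″ hM₂` (g29's text at `Lc := N`, `cH 0 := cH`, `r := R.s (j+1)`) with
their remainders `RW RW″ RB RB″ RM` classified at one rate (`hcls0`) and row-parity-odd.  CONCLUSION:
`WardTransversal (flipK (hessKer (AN R j) (vertexOfK (AN R j) N (SrecOf 3 N V H (fun _ ↦ AN R j) cE cVH cΛ 0)) (WrecOf 3 N (fun _ ↦ AN R j) (SpureRecOf 3 N V H (fun _ ↦ AN R j) cE cVH cΛ) M cE₂ cB T vh₂S mixFF 0)))`. -/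
theorem wardTransversal_AN_of_letters
    {V H : Fin (3 + 1) → (Fin (3 + 1) → ℤ) → MKer (3 + 1) (Fib 3)}
    (hV : ∀ δ : ℝ, 0 ≤ δ → ∃ C : ℝ, LocStencil V C δ) (hH : ∀ δ : ℝ, 0 ≤ δ → ∃ C : ℝ, VertexFamily H (Lc ^ (j + 1)) C δ)
    (hVt : ∀ (κ : Fin (3 + 1)) (u t : Fin (3 + 1) → ℤ), V κ (u + (((Lc ^ (j + 1) : ℕ) : ℤ)) • t) = shiftK (-((((Lc ^ (j + 1) : ℕ) : ℤ)) • t)) (V κ u))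
    (hHt : ∀ (μ : Fin (3 + 1)) (y t : Fin (3 + 1) → ℤ), H μ (y + t) = shiftK (-((((Lc ^ (j + 1) : ℕ) : ℤ)) • t)) (H μ y))
    (hVp : ∀ (κ : Fin (3 + 1)) (u : Fin (3 + 1) → ℤ), trK (V κ u) = -sgnK (V κ u))
    (hHp : ∀ (μ : Fin (3 + 1)) (y : Fin (3 + 1) → ℤ), trK (H μ y) = -sgnK (H μ y))
    {M : ℕ → Fin (3 + 1) → (Fin (3 + 1) → ℤ) → MKer (3 + 1) (Fib 3)} (hM : ∀ j' : ℕ, ∃ CM δ : ℝ, 0 < δ ∧ VertexFamily (M j') (Lc ^ (j + 1)) CM δ)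
    (hMt : ∀ (j' : ℕ) (μ : Fin (3 + 1)) (w t : Fin (3 + 1) → ℤ), M j' μ (w + t) = shiftK (-((((Lc ^ (j + 1) : ℕ) : ℤ)) • t)) (M j' μ w))
    (cE cVH cΛ cE₂ cB : ℝ) (hM0 : M 0 = cΛ • H) (T : Fin 4 → Fin 4 → Fin 4 → Fin 4 → ℝ)
    {vh₂S : Fin (3 + 1) → (Fin (3 + 1) → ℤ) → Fin (3 + 1) → (Fin (3 + 1) → ℤ) → MKer (3 + 1) (Fib 3)} (hB : ∃ C δ : ℝ, 0 < δ ∧ LocStencil₂ vh₂S C δ)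
    (hBt : ∀ (κ : Fin (3 + 1)) (u : Fin (3 + 1) → ℤ) (κ' : Fin (3 + 1)) (u' t : Fin (3 + 1) → ℤ),
      vh₂S κ (u + (((Lc ^ (j + 1) : ℕ) : ℤ)) • t) κ' (u' + (((Lc ^ (j + 1) : ℕ) : ℤ)) • t) = shiftK (-((((Lc ^ (j + 1) : ℕ) : ℤ)) • t)) (vh₂S κ u κ' u'))
    {mixFF : Fin (3 + 1) → (Fin (3 + 1) → ℤ) → Fin (3 + 1) → (Fin (3 + 1) → ℤ) → MKer (3 + 1) (Fib 3)} (hmix : ∃ C δ : ℝ, 0 < δ ∧ LocStencilFM (Lc ^ (j + 1)) mixFF C δ)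
    (hmixt : ∀ (κ : Fin (3 + 1)) (u : Fin (3 + 1) → ℤ) (μ : Fin (3 + 1)) (w t : Fin (3 + 1) → ℤ),
      mixFF κ (u + (((Lc ^ (j + 1) : ℕ) : ℤ)) • t) μ (w + t) = shiftK (-((((Lc ^ (j + 1) : ℕ) : ℤ)) • t)) (mixFF κ u μ w))
    (ξ : ℝ)
    -- (S)_j: the first-order Ward law of the member-0 stencil family against the conjugated bordered Hessian, and its transported form
    (hSd : ∀ y : Fin (3 + 1) → ℤ, ((((Lc ^ (j + 1) : ℕ) : ℝ)) ^ (3 + 1))⁻¹ • ∑ v ∈ box (3 + 1) (Lc ^ (j + 1)),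
        divV (SrecOf 3 (Lc ^ (j + 1)) V H (fun _ => AN R j) cE cVH cΛ 0) ((((Lc ^ (j + 1) : ℕ) : ℤ)) • y + toSite v)
      = conjV (bhKcomp (d := 3) R.rc Lc (j + 1)) (diagK (ξ • ∑ v ∈ box (3 + 1) (Lc ^ (j + 1)), legInd (toSite (R.s (j + 1))) ((((Lc ^ (j + 1) : ℕ) : ℤ)) • y + toSite v))))
    (hD : ∀ y : Fin (3 + 1) → ℤ, divV (dM (AN R j) (Lc ^ (j + 1)) (SpureRecOf 3 (Lc ^ (j + 1)) V H (fun _ => AN R j) cE cVH cΛ 0) (M 0)) y =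
      conjV (bhKcomp (d := 3) R.rc Lc (j + 1)) (diagK (ξ • ∑ v ∈ box (3 + 1) (Lc ^ (j + 1)), legInd (toSite (R.s (j + 1))) ((((Lc ^ (j + 1) : ℕ) : ℤ)) • y + toSite v))))
    -- (W)_j: the three level-0 LETTERS, remainders classified (one rate) and row-parity-odd
    {RW RW'' RB RB'' : (Fin (3 + 1) → ℤ) → Fin (3 + 1) → (Fin (3 + 1) → ℤ) → MKer (3 + 1) (Fib 3)}
    {RM : (Fin (3 + 1) → ℤ) → Fin (3 + 1) → (Fin (3 + 1) → ℤ) → MKer (3 + 1) (Fib 3)}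
    (hcls0 : ∃ C δ : ℝ, 0 < δ ∧ (∀ Y, LocStencil (RW Y) C δ) ∧ (∀ Y, LocStencil (RW'' Y) C δ) ∧ (∀ Y, LocStencil (RB Y) C δ) ∧
      (∀ Y, LocStencil (RB'' Y) C δ) ∧ (∀ y, VertexFamily (RM y) (Lc ^ (j + 1)) C δ))
    (hRWp : ∀ Y κ u, trK (RW Y κ u) = -sgnK (RW Y κ u)) (hRW''p : ∀ Y κ u, trK (RW'' Y κ u) = -sgnK (RW'' Y κ u))
    (hRBp : ∀ Y κ u, trK (RB Y κ u) = -sgnK (RB Y κ u)) (hRB''p : ∀ Y κ u, trK (RB'' Y κ u) = -sgnK (RB'' Y κ u))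
    (hRMp : ∀ y ρ' w, trK (RM y ρ' w) = -sgnK (RM y ρ' w))
    (hWil : ∀ (Y : Fin (3 + 1) → ℤ) (κ' : Fin (3 + 1)) (u' : Fin (3 + 1) → ℤ),
      ((((Lc ^ (j + 1) : ℕ) : ℝ)) ^ (3 + 1))⁻¹ • ∑ v ∈ box (3 + 1) (Lc ^ (j + 1)), divV (fun κ u => cE₂ • wilsonW₂ 3 T κ u κ' u') ((((Lc ^ (j + 1) : ℕ) : ℤ)) • Y + toSite v) =
        comp (cE • wilsonA 3 κ' u') (diagK (ξ • ∑ v ∈ box (3 + 1) (Lc ^ (j + 1)), legInd (toSite (R.s (j + 1))) ((((Lc ^ (j + 1) : ℕ) : ℤ)) • Y + toSite v)))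
          - comp (diagK (ξ • ∑ v ∈ box (3 + 1) (Lc ^ (j + 1)), legInd (toSite (R.s (j + 1))) ((((Lc ^ (j + 1) : ℕ) : ℤ)) • Y + toSite v))) (cE • wilsonA 3 κ' u') + RW Y κ' u')
    (hWil'' : ∀ (Y : Fin (3 + 1) → ℤ) (κ : Fin (3 + 1)) (u : Fin (3 + 1) → ℤ),
      ((((Lc ^ (j + 1) : ℕ) : ℝ)) ^ (3 + 1))⁻¹ • ∑ v ∈ box (3 + 1) (Lc ^ (j + 1)), divV (fun κ' u' => cE₂ • wilsonW₂ 3 T κ u κ' u') ((((Lc ^ (j + 1) : ℕ) : ℤ)) • Y + toSite v) =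
        comp (cE • wilsonA 3 κ u) (diagK (ξ • ∑ v ∈ box (3 + 1) (Lc ^ (j + 1)), legInd (toSite (R.s (j + 1))) ((((Lc ^ (j + 1) : ℕ) : ℤ)) • Y + toSite v)))
          - comp (diagK (ξ • ∑ v ∈ box (3 + 1) (Lc ^ (j + 1)), legInd (toSite (R.s (j + 1))) ((((Lc ^ (j + 1) : ℕ) : ℤ)) • Y + toSite v))) (cE • wilsonA 3 κ u) + RW'' Y κ u)
    (hBord : ∀ (Y : Fin (3 + 1) → ℤ) (κ' : Fin (3 + 1)) (u' : Fin (3 + 1) → ℤ),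
      ((((Lc ^ (j + 1) : ℕ) : ℝ)) ^ (3 + 1))⁻¹ • ∑ v ∈ box (3 + 1) (Lc ^ (j + 1)), divV (fun κ u => cB • vh₂S κ u κ' u') ((((Lc ^ (j + 1) : ℕ) : ℤ)) • Y + toSite v) =
        comp (cVH • V κ' u') (diagK (ξ • ∑ v ∈ box (3 + 1) (Lc ^ (j + 1)), legInd (toSite (R.s (j + 1))) ((((Lc ^ (j + 1) : ℕ) : ℤ)) • Y + toSite v)))
          - comp (diagK (ξ • ∑ v ∈ box (3 + 1) (Lc ^ (j + 1)), legInd (toSite (R.s (j + 1))) ((((Lc ^ (j + 1) : ℕ) : ℤ)) • Y + toSite v))) (cVH • V κ' u') + RB Y κ' u')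
    (hBord'' : ∀ (Y : Fin (3 + 1) → ℤ) (κ : Fin (3 + 1)) (u : Fin (3 + 1) → ℤ),
      ((((Lc ^ (j + 1) : ℕ) : ℝ)) ^ (3 + 1))⁻¹ • ∑ v ∈ box (3 + 1) (Lc ^ (j + 1)), divV (fun κ' u' => cB • vh₂S κ u κ' u') ((((Lc ^ (j + 1) : ℕ) : ℤ)) • Y + toSite v) =
        comp (cVH • V κ u) (diagK (ξ • ∑ v ∈ box (3 + 1) (Lc ^ (j + 1)), legInd (toSite (R.s (j + 1))) ((((Lc ^ (j + 1) : ℕ) : ℤ)) • Y + toSite v)))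
          - comp (diagK (ξ • ∑ v ∈ box (3 + 1) (Lc ^ (j + 1)), legInd (toSite (R.s (j + 1))) ((((Lc ^ (j + 1) : ℕ) : ℤ)) • Y + toSite v))) (cVH • V κ u) + RB'' Y κ u)
    (hM₂ : ∀ (y : Fin (3 + 1) → ℤ) (ρ' : Fin (3 + 1)) (w : Fin (3 + 1) → ℤ),
      ((((Lc ^ (j + 1) : ℕ) : ℝ)) ^ (3 + 1))⁻¹ • ∑ v ∈ box (3 + 1) (Lc ^ (j + 1)), divV (fun κ u => M2Of 3 (Lc ^ (j + 1)) mixFF 0 κ u ρ' w) ((((Lc ^ (j + 1) : ℕ) : ℤ)) • y + toSite v) =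
        comp (M 0 ρ' w) (diagK (ξ • ∑ v ∈ box (3 + 1) (Lc ^ (j + 1)), legInd (toSite (R.s (j + 1))) ((((Lc ^ (j + 1) : ℕ) : ℤ)) • y + toSite v)))
          - comp (diagK (ξ • ∑ v ∈ box (3 + 1) (Lc ^ (j + 1)), legInd (toSite (R.s (j + 1))) ((((Lc ^ (j + 1) : ℕ) : ℤ)) • y + toSite v))) (M 0 ρ' w) + RM y ρ' w) :
    WardTransversal (flipK (hessKer (AN R j)
      (vertexOfK (AN R j) (Lc ^ (j + 1)) (SrecOf 3 (Lc ^ (j + 1)) V H (fun _ => AN R j) cE cVH cΛ 0))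
      (WrecOf 3 (Lc ^ (j + 1)) (fun _ => AN R j) (SpureRecOf 3 (Lc ^ (j + 1)) V H (fun _ => AN R j) cE cVH cΛ) M cE₂ cB T vh₂S mixFF 0))) := by
  have hN : 1 ≤ Lc ^ (j + 1) := one_le_of_neZero (Lc ^ (j + 1))
  have hG : ∀ j' : ℕ, ∃ δ C : ℝ, 0 < δ ∧ 0 ≤ C ∧ Decays ((fun _ : ℕ => AN R j) j') C δ := fun _ => decays_AN R j
  have hGt : ∀ (j' : ℕ) (t : Fin (3 + 1) → ℤ), shiftK (-((((Lc ^ (j + 1) : ℕ) : ℤ)) • t)) ((fun _ : ℕ => AN R j) j') = (fun _ : ℕ => AN R j) j' :=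
    fun _ t => shiftK_AN_all Lc R j t
  have hS : ∀ j' : ℕ, ∃ Cs δ : ℝ, 0 < δ ∧ LocStencil (SpureRecOf 3 (Lc ^ (j + 1)) V H (fun _ => AN R j) cE cVH cΛ j') Cs δ :=
    locStencil_SpureRecOf (d := 3) hN hV hH hG cE cVH cΛ
  -- the multiplier table at member 0: class socket of (c1)₀ and its row parity
  have hc1 : ∀ (κ : Fin (3 + 1)) (u : Fin (3 + 1) → ℤ),
      dM (AN R j) (Lc ^ (j + 1)) (SpureRecOf 3 (Lc ^ (j + 1)) V H (fun _ => AN R j) cE cVH cΛ 0) (M 0) κ u =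
        vertexOfK (AN R j) (Lc ^ (j + 1)) (SrecOf 3 (Lc ^ (j + 1)) V H (fun _ => AN R j) cE cVH cΛ 0) κ u := fun κ u => by
    rw [hM0]; exact dM_SpureRecOf_zero_eq_vertexOfK_SrecOf_AN R j hV hH (fun _ => AN R j) cE cVH cΛ κ u
  have hMp : ∀ (ρ : Fin (3 + 1)) (w : Fin (3 + 1) → ℤ), trK (M 0 ρ w) = -sgnK (M 0 ρ w) := fun ρ w => by
    rw [hM0]; exact parityOdd_smul cΛ (hHp ρ w)
  -- the W-side sockets from the letters (PART 112 §2)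
  obtain ⟨Nr, hNr, hN0, -, hWd⟩ := exists_wardSide_zero_of_letters_slot (G := fun _ => AN R j) (M := M) hN hV hH hG hM cE cVH cΛ cE₂ cB T hB hmix
    (spr_bhKcomp Lc R j) (spr_axEc_AN Lc R j) (relInv_AN Lc R j) (((((Lc ^ (j + 1) : ℕ) : ℝ)) ^ (3 + 1))⁻¹)
    (fun y κ' u => colH_ward_AN Lc R j y κ' u) (fun y ρ w => colM_ward_AN Lc R j y ρ w) (fun x hx z ρ μ => AN_inr_inr_off Lc R j hx z ρ μ)
    (r := R.s (j + 1)) ξ (fun y => comp_axEc_diagK_smul_sum_legInd_comm (Lc ^ (j + 1)) (toSite (R.s (j + 1))) (toSite (R.s (j + 1))) ξ y) hD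
    hc1 (trK_AN R j) (trK_SpureRecOf (Lc := Lc ^ (j + 1)) hV hH hG (fun _ => trK_AN R j) hVp hHp cE cVH cΛ 0) hMp
    hcls0 hRWp hRW''p hRBp hRB''p hRMp hWil hWil'' hBord hBord'' hM₂
  -- class and block covariance of the two families, one common rate
  obtain ⟨Cs, δs, hδs, hSl⟩ := locStencil_SrecOf (d := 3) hN hV hH hG cE cVH cΛ 0
  obtain ⟨Cw, δw, hδw, hWl⟩ := vertexFamily₂_WrecOf' cE₂ cB T vh₂S mixFF hN hG hS hM hB hmix 0
  have hCs : 0 ≤ Cs := (hSl 0 0).nonneg (Sum.inl 0)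
  have hCw : 0 ≤ Cw := (hWl 0 0 0 0).nonneg (Sum.inl 0)
  obtain ⟨CK, δK, hδK, hKd⟩ := exists_decays_AN Lc R j
  exact wardTransversal_flipK_hessKer_vertexOfK_of_letters (N := Lc ^ (j + 1)) hKd hδK (shiftK_AN_all Lc R j) hN
    (spr_bhKcomp Lc R j) (spr_axEc_AN Lc R j) (relInv_AN Lc R j) (lt_min hδs hδw)
    (locStencil_mono hSl hCs (min_le_left _ _)) (vertexFamily₂_mono hWl hCw (min_le_right _ _))
    (fun κ' u t => SrecOf_translate hVt hHt hGt cE cVH cΛ 0 κ' u t)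
    (fun μ y ν y' t => WrecOf_translate cE₂ cB T hGt (SpureRecOf_translate hVt hHt hGt cE cVH cΛ) hMt hBt hmixt 0 μ y ν y' t)
    (((((Lc ^ (j + 1) : ℕ) : ℝ)) ^ (3 + 1))⁻¹) (fun y κ' u => colH_ward_AN Lc R j y κ' u)
    (fun y => diagK (ξ • ∑ v ∈ box (3 + 1) (Lc ^ (j + 1)), legInd (toSite (R.s (j + 1))) ((((Lc ^ (j + 1) : ℕ) : ℤ)) • y + toSite v)))
    (fun y => loc_diagK_smul_sum_legInd (Lc ^ (j + 1)) (toSite (R.s (j + 1))) ξ y)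
    (fun y => comp_axEc_diagK_smul_sum_legInd_comm (Lc ^ (j + 1)) (toSite (R.s (j + 1))) (toSite (R.s (j + 1))) ξ y)
    (fun _ _ _ => 0) Nr (fun _ _ _ => loc_zero) hNr (fun _ _ _ => by rw [comp_zero_left, comp_zero_right]) hSd hWd hN0

end Summit.QuantumFields.BalabanUV.Beta.FP.TowerNWardOfLetters

end
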